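import Summits.CriticalPhenomena.PercolationContinuityZ3.Theorems.Transplant.SkelPhiForcedRootKitClauseC
import Summits.CriticalPhenomena.PercolationContinuityZ3.Theorems.Transplant.SkelPhiForcedKitClauseCQ
import Summits.CriticalPhenomena.PercolationContinuityZ3.Theorems.Transplant.SkelPhiQStepsNMaps
import HarnessLib

/-!
# Quasi-step rung (N3-b), BINDER WAVE, row Q32 «SkelPhiForcedRootKitClauseC» of WAVE-Q-BINDER-rows v0.7 under (ι) := `Skelφ.QStepsN G φ M`: **THE FORCED KIT CLAUSE
# OF A WINDOW LEVEL IN THE ROOT FRAME** when the base chart has only exact-footprint quasi-steps of cost `M` — **`kitClause_rootFrameFC_q`**, the twin of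
# «SkelPhiForcedRootKitClauseC» `kitClause_rootFrameFC` (which assumed `Steps G φ`)

builds on p205010 (kernel theorem, internal audit signed; external expert review pending) — nothing in this file uses p205010; nothing here is a claim about any open node
((N3-b), the end state); no carrier, no node, no definition.  Lane `prim-bschramm`, seat `prim-hp-8` (gen 62; binder-wave pen, family Forced*/Root*/RunKits/ApronKitDefs —
captain gen-1 g4, lane INBOX 2026-08-27 07:25Z).  thm row; FLOORS: `hPN : 1 ≤ P.N ↦ M ≤ P.N` (the window cost dominates the base cost), `KCmax ↦ P.N·KCmax` in `hDw`/`hT`/`hr₀`/`hrs`,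
column cardinality `KCmax + 1 ↦ (KCmax+1)(P.N+2)` in `hcS`.  Helper file (`--supports stmt-CriticalPhenomena-4575 --as helper`).
WHY (hunk classes (i) binder `(hstep : Steps G φ) ↦ {M : ℕ} (hqφ : QStepsN G φ M)`; (ii) call sites `qStepsN_of_steps (steps_rootFrame hstep t hσ) ↦ hqφ.rootFrame t hσ`
(«SkelPhiQStepsNMaps» p504935), `kitClauseFC … hstep ↦ kitClauseFC_q … (hqφ.mono hPN)` («SkelPhiForcedKitClauseCQ» Q25; the window cost `P.N` bounds the base chart's cost —
located item L-hp8-1 (b), captain R-1), `ctColEnd ↦ ctColEndQ` («SkelPhiForcedColumnQ» Q06); (iv) floors as above).  Proof otherwise byte-identical.  Regression: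
`qStepsN_of_steps` (`M = 1`).
* **`kitClause_rootFrameFC_q`**.
[cite: KozmaNitzan2024, §4 Lemma 10 (pp. 17–21)] [cite: GrimmettPercolation1999, §7.2]
-/

noncomputable section

open scoped Classical

namespace Summit.CriticalPhenomena.PercolationContinuityZ3.Theorems.Transplant

namespace Skelφ

open MeasureTheory
open Literature.Probability.Percolation Literature.Probability.LatticeModels SimpleGraph KNLevels
open Literature.Barriers.CriticalPhenomena (graphBall graphBall_finite mem_graphBall_self graphBall_mono)
open Skel (winGraph winGraph_adj winGraph_le KitGeom)
open SkelI (tanOff tanTgt tanTgt_mem)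
open Literature.Probability.Percolation.KozmaNitzan.Cells (oth oth_ne eq_oth_of_ne oth_oth)

variable {V : Type} [DecidableEq V] {G : SimpleGraph V} [G.LocallyFinite] {φ : V → Site 2}

/-- **THE FORCED KIT CLAUSE OF A WINDOW LEVEL IN THE ROOT FRAME.** Level box `[lo − j, hi + j]` of `rootFrame φ t σ` around `w₀` (radius `R`); kit
constants `P` (`M ≤ P.N`, `P.A = nz + 2`, `d + 2 ≤ shellD`, `Rs + 1 ≤ shellD`, `shellD + nz + 1 ≤ KCmax`); short region `Rg`; the zone datum `Λc` at the
kit centres of the root side forms; per contact: far ⇒ inner neighbour in the target; near ⇒ a zone-box vertex in the target or the route datum at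
accuracy `δ³`.  Conclusion: the per-level clause of `TStep.KitsAtF`. [cite: KozmaNitzan2024, §4 Lemma 10 (pp. 17–21)] -/
theorem kitClause_rootFrameFC_q [Countable V] (hlipφ : Lip G φ) {M : ℕ} (hqφ : QStepsN G φ M) {Δ : ℕ} (hΔ : ∀ v, G.degree v ≤ Δ) {q : unitInterval} {δ : ℝ}
    (hδ : 0 < δ)
    -- the root frame
    (t : V) {σ : ℤ} (hσ : σ = 1 ∨ σ = -1)
    -- the level box and the window
    {lo hi : Site 2} {j : ℕ} {w₀ : V} {R : ℕ}
    -- kit constants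
    (P : ApronPrm) {nz Rs KCmax rs cS cU : ℕ} (hPN : M ≤ P.N) (hA : P.A = (nz : ℤ) + 2)
    (hdD : P.d + 2 ≤ shellD P) (hDρ : Rs + 1 ≤ shellD P) (hKCmax : shellD P + nz + 1 ≤ KCmax)
    (hwide : ∀ i, (lo - (j : Site 2)) i + 2 * tanOff P.ℓs P.M ≤ (hi + (j : Site 2)) i)
    (hdw : ∀ i, (lo - (j : Site 2)) i + (P.d + 2 : ℕ) ≤ (hi + (j : Site 2)) i)
    (hDw : ∀ i, (lo - (j : Site 2)) i + ((shellD P + 1 + P.d + P.N * KCmax + Rs : ℕ) : ℤ) ≤ (hi + (j : Site 2)) i)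
    (hT : (shellD P : ℤ) + P.N * KCmax + Rs ≤ tanOff P.ℓs P.M)
    (hr₀ : P.N * (tanOff P.ℓs P.M + 2) + P.N * P.d + (P.N * KCmax + Rs) ≤ P.r₀) (hR : P.r₀ ≤ R)
    (hrs : 1 + (P.N * (tanOff P.ℓs P.M + 2) + P.N * P.d + (P.N * KCmax + Rs)) ≤ rs)
    (hcS : (P.N + 1) * (tanOff P.ℓs P.M + 1) + (P.N + 1) * P.d + (KCmax + 1) * (P.N + 2) + cU ≤ cS)
    -- the short region and the zone datum
    (Rg : V → Finset V) (hRg : ∀ c, ∀ u ∈ Rg c, u ∈ graphBall G c Rs) (hRgcard : ∀ c, (Rg c).card ≤ cU) (hcU1 : 1 ≤ cU)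
    (Λc : V → ℕ → Finset V) (kz : ℕ) (hΛRg : ∀ c, Λc c kz ⊆ Rg c) (hzconn : ∀ c, ∀ s ∈ Λc c kz, PathIn G (↑(Λc c kz) : Set V) c s)
    (hcz : ∀ c, c ∈ Λc c kz)
    -- the level's source/support, the weighting, the region and the target
    (k : ℕ) (o : V) (Sfin : Finset V) {Wt : Sym2 V → unitInterval} {D T : Finset V}
    (hXD : winLevel G (rootFrame φ t σ) w₀ R lo hi j ⊆ D) {N : ℕ} (hN : k * (Δ + 1) ^ (2 * rs) ≤ N)
    (hk : (1 - (q : ℝ) ^ (1 + Δ * cS + cS * cU)) ^ k ≤ δ)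
    -- per contact
    (hfar : ∀ x ∈ outerBoundary (winGraph G w₀ R) (winLevel G (rootFrame φ t σ) w₀ R lo hi j),
      ¬ IsNear G (rootFrame φ t σ) (lo - (j : Site 2)) (hi + (j : Site 2)) P w₀ R x →
      ctY G (rootFrame φ t σ) w₀ R (lo - (j : Site 2)) (hi + (j : Site 2)) x ∈ T)
    (hnear : ∀ x ∈ outerBoundary (winGraph G w₀ R) (winLevel G (rootFrame φ t σ) w₀ R lo hi j),
      IsNear G (rootFrame φ t σ) (lo - (j : Site 2)) (hi + (j : Site 2)) P w₀ R x →
      (∃ u ∈ Λc (ctColEndQ G (rootSideU (φ := φ) t hσ (lo - (j : Site 2)) (hi + (j : Site 2))) P w₀ R x) kz, u ∈ T) ∨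
      ∃ Qt Ft : Finset V, Ft ⊆ T ∧ Qt ⊆ D ∧
        1 - δ ^ 3 ≤ (prodBernoulli Wt).real (linkIn (↑Qt : Set V)
          (Λc (ctColEndQ G (rootSideU (φ := φ) t hσ (lo - (j : Site 2)) (hi + (j : Site 2))) P w₀ R x) kz) Ft)) :
    ∃ (σ' : SData V) (S : Finset V), SHyp (winLData G (rootFrame φ t σ) w₀ R lo hi o Sfin) j σ' ∧ σ'.N ≤ N ∧
      (1 - (q : ℝ) ^ σ'.sB) ^ σ'.k ≤ δ ∧ S ⊆ D ∧ (∀ x ∈ σ'.K, σ'.face x ⊆ S) ∧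
      RelayClause (winLData G (rootFrame φ t σ) w₀ R lo hi o Sfin) Wt j σ' S T D δ := by
  set SF := rootSideU (φ := φ) t hσ (lo - (j : Site 2)) (hi + (j : Site 2)) with hSF
  have hU1 : (1 : ℤ) ≤ 1 := le_rfl
  have haff : ∀ (i : Fin 2) (σ₀ : ℤˣ), (SF i σ₀).IsAffine 1 ((fun _ _ => (1 : ℤ)) i σ₀) := fun i σ₀ => by
    rw [hSF]; exact rootSideU_isAffine t hσ _ _ i σ₀
  have hC : ∀ (i : Fin 2) (σ₀ : ℤˣ), ((1 : ℕ) : ℤ) ≤ (fun _ _ => (1 : ℤ)) i σ₀ := fun _ _ => by simp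
  have hU : (1 : ℤ) ≤ ((0 + 1 : ℕ) : ℤ) * (1 : ℕ) := by simp
  have hA' : P.A = ((nz + 1 : ℕ) : ℤ) * 1 + 1 := by rw [hA]; push_cast; ring
  have hA0 : 0 ≤ P.A := by rw [hA]; positivity
  have hKCmax' : (shellD P + nz + 1) * (0 + 1) ≤ KCmax := by simpa using hKCmax
  exact kitClauseFC_q SF Rg (lip_rootFrame hlipφ t hσ) ((hqφ.rootFrame t hσ).mono hPN) (hqφ.mono hPN) hΔ hδ hwide hdw
    (fun i σ₀ z hz _ => hKC_of_affine SF haff hU1 P (le_refl 1) hC hU hA' hKCmax' i σ₀ z hz) hA0 (hθA_of_affine SF haff hU1 P hA0 hdD)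
    hr₀ hR hT hDw hDρ hRg hRgcard hcU1 hrs hcS hΛRg hzconn hcz k o Sfin hXD hN hk hfar hnear

end Skelφ

end Summit.CriticalPhenomena.PercolationContinuityZ3.Theorems.Transplant

end
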